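import Mathlib
import HarnessLib
import Summits.HubbardSuperconductivity.HubbardSuperconductivity.Theorems.ComplexGFFStiffnessDefs

/-!
# Crux `HypACumulant`, line `gnv` — `ι`-symmetry bookkeeping (route plan item N5, abstract form)

Route `route-HubbardSuperconductivity-ComplexGFFStiffness`, cruxes stmt-HubbardSuperconductivity-19154 /
19155, research stub `stub_gnvOfFrd : TorusFRD 4 → GNV`.  The bet of the line is that the printed
renormalisation group (Adams–Buchholz–Kotecký–Müller, arXiv:1910.13564) runs verbatim on COMPLEX
functionals obeying the reflection symmetry `F(−φ) = conj F(φ)` ("`ι`-symmetry"), because every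
constituent operation preserves that symmetry and the coefficients it extracts in even degree
(energy, quadratic form to be fine-tuned) are then automatically REAL.  This file proves the
model-independent half of that claim once and for all, for functionals on an arbitrary real normed
space (resp. measurable additive group):

* closure of the `ι`-symmetric class under sums, products, finite products over sites, `exp`, and
  `1 + ·` (the algebra of polymer activities);
* `iota_integral_add` — convolution with ANY reflection-invariant measure (in particular every
  centred Gaussian, i.e. every step `R_k^{(q)} F = ∫ F(· + ζ) μ_k^{(q)}(dζ)` of the printed flow with a
  REAL covariance) preserves `ι`-symmetry — no integrability needed;
* `iota_iteratedFDeriv` — for a `C^k` `ι`-symmetric `F`: `conj (D^k F(x) m) = (−1)^k D^k F(−x) m`;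
  hence at the origin (`iota_iteratedFDeriv_zero_even/odd`) the Taylor coefficients of even degree
  are real and those of odd degree purely imaginary — the extracted relevant Hamiltonian
  `λ + ℓ·∇φ + ½∇φ·q∇φ` of an `ι`-symmetric activity has `λ, q` real and `ℓ` imaginary, so the
  fine-tuned Gaussian stays a genuine (real) Gaussian.

What is NOT here: the renormalisation maps themselves (they need the polymer/norm interface).

## References
* S. Adams, S. Buchholz, R. Kotecký, S. Müller, arXiv:1910.13564, Ch. 4 and Ch. 7 (the maps
  `R^{(q)}_k`, the projection `Π₂` onto relevant Hamiltonians by second-order Taylor expansion).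
-/

noncomputable section

-- `Summit.<Summit>.<Problem>`: single-conjunct summit, the duplicate component is mandated (D-0017).
set_option linter.dupNamespace false

namespace Summit.HubbardSuperconductivity.HubbardSuperconductivity.Theorems.ComplexGFF

open scoped BigOperators ComplexConjugate
open MeasureTheory

section Algebra

variable {V : Type*} [AddCommGroup V]

/-- sums of `ι`-symmetric functionals are `ι`-symmetric. -/
theorem iota_add {F G : V → ℂ} (hF : ∀ v, F (-v) = conj (F v)) (hG : ∀ v, G (-v) = conj (G v)) :
    ∀ v, (F + G) (-v) = conj ((F + G) v) := fun v => by
  simp only [Pi.add_apply, hF, hG, map_add]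

/-- products of `ι`-symmetric functionals are `ι`-symmetric. -/
theorem iota_mul {F G : V → ℂ} (hF : ∀ v, F (-v) = conj (F v)) (hG : ∀ v, G (-v) = conj (G v)) :
    ∀ v, (F * G) (-v) = conj ((F * G) v) := fun v => by
  simp only [Pi.mul_apply, hF, hG, map_mul]

/-- real constants are `ι`-symmetric. -/
theorem iota_const (r : ℝ) : ∀ v : V, (fun _ : V => (r : ℂ)) (-v) = conj ((fun _ : V => (r : ℂ)) v) :=
  fun v => by simp only [Complex.conj_ofReal]

/-- `1 + F` is `ι`-symmetric if `F` is (activities `1 + K`). -/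
theorem iota_one_add {F : V → ℂ} (hF : ∀ v, F (-v) = conj (F v)) :
    ∀ v, (fun w => 1 + F w) (-v) = conj ((fun w => 1 + F w) v) := fun v => by
  simp only [hF, map_add, map_one]

/-- `exp ∘ F` is `ι`-symmetric if `F` is (Boltzmann factors `e^{−H}` with `H` `ι`-symmetric). -/
theorem iota_exp {F : V → ℂ} (hF : ∀ v, F (-v) = conj (F v)) :
    ∀ v, Complex.exp (F (-v)) = conj (Complex.exp (F v)) := fun v => by
  rw [hF, Complex.exp_conj]

/-- finite sums (over polymers, sites, …) of `ι`-symmetric functionals are `ι`-symmetric. -/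
theorem iota_finset_sum {ι : Type*} (s : Finset ι) {F : ι → V → ℂ}
    (hF : ∀ i ∈ s, ∀ v, F i (-v) = conj (F i v)) :
    ∀ v, (∑ i ∈ s, F i (-v)) = conj (∑ i ∈ s, F i v) := fun v => by
  rw [map_sum]
  exact Finset.sum_congr rfl (fun i hi => hF i hi v)

/-- finite products (over the sites of a polymer, …) of `ι`-symmetric functionals are
`ι`-symmetric. -/
theorem iota_finset_prod {ι : Type*} (s : Finset ι) {F : ι → V → ℂ}
    (hF : ∀ i ∈ s, ∀ v, F i (-v) = conj (F i v)) :
    ∀ v, (∏ i ∈ s, F i (-v)) = conj (∏ i ∈ s, F i v) := fun v => by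
  rw [map_prod]
  exact Finset.prod_congr rfl (fun i hi => hF i hi v)

/-- pull-back along an odd (e.g. linear) map preserves `ι`-symmetry (site maps `φ ↦ ∇φ(x)`,
rescalings, block restrictions). -/
theorem iota_comp_odd {W : Type*} [AddCommGroup W] {F : V → ℂ} (hF : ∀ v, F (-v) = conj (F v))
    {T : W → V} (hT : ∀ w, T (-w) = -T w) : ∀ w, (F ∘ T) (-w) = conj ((F ∘ T) w) := fun w => by
  simp only [Function.comp_apply, hT, hF]

/-- an `ι`-symmetric functional is real at the origin. -/
theorem iota_apply_zero_real {F : V → ℂ} (hF : ∀ v, F (-v) = conj (F v)) : conj (F 0) = F 0 := by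
  have h := hF 0
  rw [neg_zero] at h
  exact h.symm

end Algebra

section Convolution

variable {V : Type*} [AddCommGroup V] [MeasurableSpace V] [MeasurableNeg V]

/-- **Convolution with a reflection-invariant measure preserves `ι`-symmetry**: if `μ` is invariant
under `ζ ↦ −ζ` (every centred Gaussian measure is) and `F(−v) = conj F(v)`, then
`G(φ) = ∫ F(φ + ζ) μ(dζ)` satisfies `G(−φ) = conj G(φ)`.  No integrability is needed (both sides
are `0` together).  This is the `ι`-equivariance of every Gaussian integration step `R_k^{(q)}` of
the printed renormalisation group, as long as the covariance is real. -/
theorem iota_integral_add (μ : Measure V) [μ.IsNegInvariant] {F : V → ℂ}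
    (hF : ∀ v, F (-v) = conj (F v)) (φ : V) :
    (∫ ζ, F (-φ + ζ) ∂μ) = conj (∫ ζ, F (φ + ζ) ∂μ) := by
  rw [← integral_conj, ← integral_neg_eq_self (fun ζ => F (-φ + ζ)) μ]
  refine integral_congr_ae (Filter.Eventually.of_forall (fun ζ => ?_))
  simp only []
  rw [show -φ + -ζ = -(φ + ζ) by abel, hF]

end Convolution

section Taylor

variable {V : Type*} [NormedAddCommGroup V] [NormedSpace ℝ V]

/-- **Derivatives of an `ι`-symmetric functional**: for `F` of class `C^k` with
`F(−v) = conj F(v)`, `conj (D^k F(x)(m)) = (−1)^k · D^k F(−x)(m)` for every `x` and every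
`k`-tuple of directions `m`. -/
theorem iota_iteratedFDeriv {F : V → ℂ} {k : ℕ} (hFd : ContDiff ℝ k F)
    (hF : ∀ v, F (-v) = conj (F v)) (x : V) (m : Fin k → V) :
    conj (iteratedFDeriv ℝ k F x m) = (-1 : ℂ) ^ k * iteratedFDeriv ℝ k F (-x) m := by
  set T : V →L[ℝ] V := -ContinuousLinearMap.id ℝ V with hT
  have hTapply : ∀ v, T v = -v := fun v => by simp [hT]
  -- `conj ∘ F = F ∘ (−id)` as functions
  have hfun : (⇑(Complex.conjCLE : ℂ ≃L[ℝ] ℂ) ∘ F) = (F ∘ ⇑T) := by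
    funext v
    simp only [Function.comp_apply, hTapply, hF]
    rfl
  have h2 := (Complex.conjCLE : ℂ ≃L[ℝ] ℂ).iteratedFDeriv_comp_left (f := F) (x := x) (i := k)
  have h1 := T.iteratedFDeriv_comp_right hFd x (i := k) le_rfl
  have hneg : iteratedFDeriv ℝ k F (-x) (fun i => -m i)
      = (-1 : ℂ) ^ k * iteratedFDeriv ℝ k F (-x) m := by
    have := (iteratedFDeriv ℝ k F (-x)).map_smul_univ (fun _ => (-1 : ℝ)) m
    simp only [neg_smul, one_smul, Finset.prod_const, Finset.card_univ, Fintype.card_fin] at this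
    rw [this, Complex.real_smul]
    push_cast
    ring
  calc conj (iteratedFDeriv ℝ k F x m)
      = ((Complex.conjCLE : ℂ ≃L[ℝ] ℂ) : ℂ →L[ℝ] ℂ).compContinuousMultilinearMap
          (iteratedFDeriv ℝ k F x) m := rfl
    _ = iteratedFDeriv ℝ k (⇑(Complex.conjCLE : ℂ ≃L[ℝ] ℂ) ∘ F) x m := by rw [h2]
    _ = iteratedFDeriv ℝ k (F ∘ ⇑T) x m := by rw [hfun]
    _ = (iteratedFDeriv ℝ k F (T x)).compContinuousLinearMap (fun _ => T) m := by rw [h1]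
    _ = iteratedFDeriv ℝ k F (-x) (fun i => -m i) := by
        simp only [ContinuousMultilinearMap.compContinuousLinearMap_apply, hTapply]
    _ = (-1 : ℂ) ^ k * iteratedFDeriv ℝ k F (-x) m := hneg

/-- At the origin, even-degree Taylor coefficients of an `ι`-symmetric functional are REAL … -/
theorem iota_iteratedFDeriv_zero_even {F : V → ℂ} {k : ℕ} (hFd : ContDiff ℝ k F)
    (hF : ∀ v, F (-v) = conj (F v)) (hk : Even k) (m : Fin k → V) :
    conj (iteratedFDeriv ℝ k F 0 m) = iteratedFDeriv ℝ k F 0 m := by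
  rw [iota_iteratedFDeriv hFd hF 0 m, neg_zero, hk.neg_one_pow, one_mul]

/-- … and odd-degree Taylor coefficients are purely IMAGINARY. -/
theorem iota_iteratedFDeriv_zero_odd {F : V → ℂ} {k : ℕ} (hFd : ContDiff ℝ k F)
    (hF : ∀ v, F (-v) = conj (F v)) (hk : Odd k) (m : Fin k → V) :
    conj (iteratedFDeriv ℝ k F 0 m) = -iteratedFDeriv ℝ k F 0 m := by
  rw [iota_iteratedFDeriv hFd hF 0 m, neg_zero, hk.neg_one_pow, neg_one_mul]

/-- In particular the second-order coefficient (the quadratic form that the flow fine-tunes) has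
vanishing imaginary part, and the first-order coefficient (the linear term) vanishing real part. -/
theorem iota_taylor_two_im_one_re {F : V → ℂ} (hFd : ContDiff ℝ 2 F)
    (hF : ∀ v, F (-v) = conj (F v)) (m₂ : Fin 2 → V) (m₁ : Fin 1 → V) :
    (iteratedFDeriv ℝ 2 F 0 m₂).im = 0 ∧ (iteratedFDeriv ℝ 1 F 0 m₁).re = 0 := by
  refine ⟨Complex.conj_eq_iff_im.mp (iota_iteratedFDeriv_zero_even hFd hF even_two m₂), ?_⟩
  have h := iota_iteratedFDeriv_zero_odd (hFd.of_le (by norm_num)) hF odd_one m₁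
  have hre := congrArg Complex.re h
  rw [Complex.conj_re, Complex.neg_re] at hre
  linarith

end Taylor

/-- The model's activity `𝒦_g` is `ι`-symmetric (re-export of `pertK_neg` in the closure-lemma
format). -/
theorem iota_pertK (g : ℝ) : ∀ z : Fin 4 → ℝ, pertK g (-z) = conj (pertK g z) := by
  intro z
  unfold pertK berryVertex
  simp only [Pi.neg_apply, even_two, Even.neg_pow, neg_mul, map_sub, map_one, ← Complex.exp_conj,
    map_neg, map_mul, Complex.conj_I, Complex.conj_ofReal]
  congr 2
  push_cast
  ring

end Summit.HubbardSuperconductivity.HubbardSuperconductivity.Theorems.ComplexGFF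

end
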